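import Summits.QuantumFields.BalabanUV.Beta.CombMixedT2EvenStoreyTwoLetters

/-!
# `BalabanUV.Beta.CombMixedT2EvenStoreyTwo` — binder row D1 ∕ (C1), PART 30: **(K2b) AT DEPTH 2 IS STOREYWISE — the fine pure-gauge row of the EVEN HALF of the literal's DEPTH-2 COMPOSITE
# mixed kernel `compMixKer ℓ 𝓋 𝒽 𝓉 Lc 2` (an1's (0.4)-SYM bricks at `ρ_c` at both levels) is MINUS the commutator taken LEVEL BY LEVEL, each level with the gauge function SAMPLED AT ITS OWN
# BLOCK ROOTS: `Σ'_x Σ_α (λ(x+e_α) − λ x)·compMix₂ᵉ(μ,y; (α,x), f, f′) = Σ_{b₁,b₂} (Λ(u_{b₂}) − Λ(u_{b₁}))·h(μ,y;b₁,b₂)·ℓ(b₁;f)·ℓ(b₂;f′) + (λ(x_{f′}) − λ(x_f))·Σ_b ℓ(μ,y;b)·h(b;f,f′)`,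
# `Λ(u) := λ(Lc•u + ρ_c)`** — Engine C's TIER V PHASE A closed form (`K2L-V-A.md` aa42349465e81665 §4, `γ = −1`, residual ≤ 1.9e−15) AS A THEOREM; the displayed single-generator form
# `κ₂·[E_λ, compH₂]` is NOT what holds (by value residual 0.06–0.75; by this file the difference is the explicit storey term)

WHY (journal [AN2-G70-A3]; J-NOTE-14 `HOME/b2b-balaban-beta-an2/gen70/J14-K2B-STOREYWISE.md`).  PART 25∕26 settled (K2b) at depth 1 (pure commutator, finest generator).  At depth 2 the composite
mixed kernel is `compMixKer_succ`'s five summands; under the even half in the fluctuation pair S2+S3 and S4 are transpose-ODD (`h` antisymmetric) and vanish, S5 is the depth-1 letter at each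
level-1 bond, and S1 is the depth-1 letter AT LEVEL 1 for the top brick fed the TRANSPORTED pure gauge `Σ_g ℓ(b;g)(Dλ)_g = Λ(u_b + e_κ) − Λ(u_b)` (GAN24 `tsum_sum_symLinKerAt_mul_grad`: an1's sym
linear brick maps a finest pure gauge to the level-1 pure gauge of the ROOT-SAMPLED function).  So the Ward row of the composite is the sum over the two storeys of the storey's own
commutator — the covariant statement road FP's v6 should display for `hK2b` at depth ≥ 2 (its `Rs` is otherwise the explicit difference `D_λᵀ h L1 + L1ᵀ h D_λ`).

WHAT (`d = 3`, root `ρ_c = ctr 4 Lc = toSite (ctrOff 4 Lc)`, bricks `ℓ = symLinKerAt ρ_c Lc`, `𝓋 = symVhKerAt`, `𝒽 = symHessKerAt`, `𝓉 = symMixKerAt`, constant in the level index; [folklore] finite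
re-indexing BY NAME; no `def`, no `def … : Prop`, nothing cited, 0 sorry):
§1–§2 are PART 30a `CombMixedT2EvenStoreyTwoLetters` (the depth-1 letter contracted with a gauge function `tsum_sum_grad_mul_symMixKerAt_even`; the five summands with bricks
`compMixKer_two_eq`; the parity kills; `compMixKer_two_even_eq`); here §3: `tsum_sum_grad_mul_symLinKerAt` ((W-lin)₁ read for the contraction, GAN24 `tsum_sum_symLinKerAt_mul_grad`),
`sum_offs_levelGrad_mul_symMixKerAt_even` (the depth-1 letter AT LEVEL 1, window form), **`tsum_sum_grad_mul_compMixKer_two_even`** (the display above).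
WHAT THIS IS NOT: not the torus periodisation (PART 26's engine applies verbatim to each storey term — next); not depth ≥ 3 (induction over `compMixKer_succ` with (W-lin)_m); not (J-R₂) nor v6's
reshape (the road's call); nothing of Bałaban's asserted, valued or discharged; 0 estimates; 0∕4 row-D1 binders (hW, hR, D1Tel, D1Rep); ROOT M‴ p325680 ∕ P5c ∕ D6 untouched; NOT (C1), NOT (T-ID),
NOT D1, NEVER «G-an2-4 closed», NOT BetaPertH, NOT continuum, NOT Clay.

HONEST DEPENDENCY (page 1, mandatory): continuum YM on T⁴ ⇐ BetaPertH ∧ nine spine estimates (0/9 proved); BetaPertH ⇐ (D1) ∧ (D4) ∧ CAP+tail;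
G-an2-4 gates asym, D1 and NE2/3/4.  HONEST FRAMING (cell contract, verbatim): «discharging `BetaPertH` makes Bałaban's UV stability UNCONDITIONAL —
a real constructive-QFT result; it is NOT the continuum limit and NOT the Clay problem.»  ABSOLUTE RULE (cell charter, verbatim): «No internally-minted
statement may enter as a cited fact. Every hypothesis is either kernel-proved in this package or a verbatim quotation of a PUBLISHED theorem with page
reference. The manuscript(s) under audit are NOT citable for their own disputed steps — they are the thing under adjudication; programme-internal
(2001/route/tribunal) claims are never citable.»  Row D1 ∕ (C1) OWNER an2 (b2b-balaban-beta-an2) gen 70, 2026-08-28.  No existing file touched.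
-/

noncomputable section

open scoped BigOperators

namespace Summit.QuantumFields.BalabanUV.Beta.CombMixedT2EvenStoreyTwo

open Finset
open Literature.MathematicalPhysics.QuantumFieldTheory
open Literature.MathematicalPhysics.QuantumFieldTheory.Balaban1983to89
open Literature.MathematicalPhysics.QuantumFieldTheory.Balaban1983to89.Beta
open AffineAveraging (Site box toSite unitVec dz)
open AveragingContoursRooted (ctr ctrOff ctrOff_mem_box)
open AveragingHessianKernels (Bond Near)
open ExpKernelCalculus (MKer)
open OneStepResolventKernel (Fib)
open BalabanStepW2 (M2Of wM2)
open Summit.QuantumFields.BalabanUV.Beta.TameKernelCalculus (trK)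
open Summit.QuantumFields.BalabanUV.Beta.BorderedHessian (sgnK)
open Summit.QuantumFields.BalabanUV.Beta.AxialDressingRooted (one_le_of_neZero)
open Summit.QuantumFields.BalabanUV.Beta.SymAveragingHessianCounts (symLinKerAt symVhKerAt symHessKerAt symHessFFAt symHessFFAt_inl_inl symHessKerAt_swap symLinKerAt_eq_zero
  symVhKerAt_eq_zero_left symVhKerAt_eq_zero_right symHessKerAt_eq_zero_left symHessKerAt_eq_zero_right)
open Summit.QuantumFields.BalabanUV.Beta.SymAveragingMixedJetTables (symMixFFAt symMixKerAt)
open Summit.QuantumFields.BalabanUV.Beta.SymWardLettersAn1 (wM2_eq stepScale_zero wM1_zero)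
open Summit.QuantumFields.BalabanUV.Beta.CompositeVertexKernelRec (offs compLinKer compVHKer compLinKer_one compVHKer_one near_iff_exists_offs near_smul_add_iff)
open Summit.QuantumFields.BalabanUV.Beta.CompositeMixedTable (compMixKer compMixKer_succ compMixKer_one)
open Summit.QuantumFields.BalabanUV.Beta.CombMixedT2EvenSiteLetter (sum_mixedT2_even_sub_inl_inl)
open Summit.QuantumFields.BalabanUV.Beta.CombMixedT2EvenPeriodised (mixedT2_even_inl_inl symMixKerAt_eq_zero_of_not_near_left symMixKerAt_eq_zero_of_not_near_right
  symMixKerAt_eq_zero_of_not_near_bond)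
open Summit.QuantumFields.BalabanUV.Beta.GAN24.BorderGaugeLegContact (tsum_sum_dz_mul_eq tsum_mul_ite_sub_ite_mul)
open Summit.QuantumFields.BalabanUV.Beta.GAN24.SymLinKernelExpansion (tsum_sum_symLinKerAt_mul_grad)

variable {Lc : ℕ} [NeZero Lc]

open Summit.QuantumFields.BalabanUV.Beta.CombMixedT2EvenStoreyTwoLetters (tsum_eq_sum_offs tsum_sum_grad_mul_symMixKerAt_even sum6_push2 compMixKer_two_even_eq)

/-! ## §3 (K2b) at depth 2, storeywise -/

/-- [folklore] (W-lin)₁ read for the contraction: `Σ'_x Σ_α (λ(x+e_α) − λ x)·ℓ(κ,u;(α,x)) = λ(Lc•u + ρ_c + Lc•e_κ) − λ(Lc•u + ρ_c)` — an1's sym linear brick maps a finest pure gauge to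
the level-1 pure gauge of the ROOT-sampled function (GAN24 `tsum_sum_symLinKerAt_mul_grad`). -/
theorem tsum_sum_grad_mul_symLinKerAt (lam : Site (3 + 1) → ℝ) (κ : Fin (3 + 1)) (u : Site (3 + 1)) :
    ∑' x : Site (3 + 1), ∑ α : Fin (3 + 1), (lam (x + unitVec α) - lam x) * symLinKerAt (ctr 4 Lc) Lc κ u (α, x)
      = lam ((Lc : ℤ) • (u + unitVec κ) + ctr 4 Lc) - lam ((Lc : ℤ) • u + ctr 4 Lc) := by
  have h := tsum_sum_symLinKerAt_mul_grad (one_le_of_neZero Lc) (ctrOff_mem_box (d := 3 + 1) (one_le_of_neZero Lc)) lam κ u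
  rw [show toSite (ctrOff (3 + 1) Lc) = ctr 4 Lc from rfl] at h
  rw [show (Lc : ℤ) • (u + unitVec κ) + ctr 4 Lc = (Lc : ℤ) • u + ctr 4 Lc + (Lc : ℤ) • unitVec κ by rw [smul_add]; abel, ← h]
  exact tsum_congr fun x => Finset.sum_congr rfl fun α _ => mul_comm _ _

/-- [folklore] §1's depth-1 letter AT LEVEL 1, window form: for the top brick at `(μ, y)` and two level-1 bonds `b₁ b₂`,
`Σ_κ Σ_{e ∈ offs} (Λ(Lc•y+e+e_κ) − Λ(Lc•y+e))·½(t(μ,y;(κ,Lc•y+e),b₁,b₂) + t(…,b₂,b₁)) = (Λ b₂.2 − Λ b₁.2)·h(μ,y;b₁,b₂)`, `Λ u := λ(Lc•u + ρ_c)`. -/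
theorem sum_offs_levelGrad_mul_symMixKerAt_even (lam : Site (3 + 1) → ℝ) (μ : Fin (3 + 1)) (y : Site (3 + 1)) (b₁ b₂ : Bond (3 + 1)) :
    ∑ κ : Fin (3 + 1), ∑ e ∈ offs Lc,
        (lam ((Lc : ℤ) • ((Lc : ℤ) • y + e + unitVec κ) + ctr 4 Lc) - lam ((Lc : ℤ) • ((Lc : ℤ) • y + e) + ctr 4 Lc))
          * ((1 / 2 : ℝ) * (symMixKerAt (ctr 4 Lc) Lc μ y (κ, (Lc : ℤ) • y + e) b₁ b₂ + symMixKerAt (ctr 4 Lc) Lc μ y (κ, (Lc : ℤ) • y + e) b₂ b₁))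
      = (lam ((Lc : ℤ) • b₂.2 + ctr 4 Lc) - lam ((Lc : ℤ) • b₁.2 + ctr 4 Lc)) * symHessKerAt (ctr 4 Lc) Lc μ y b₁ b₂ := by
  have hLc : 1 ≤ Lc := one_le_of_neZero Lc
  have h := tsum_sum_grad_mul_symMixKerAt_even (Lc := Lc) (fun u => lam ((Lc : ℤ) • u + ctr 4 Lc)) μ y b₁ b₂
  rw [tsum_eq_sum_offs (L := Lc) (y := y)] at h
  · rw [Finset.sum_comm]
    exact h
  · intro u hu
    refine Finset.sum_eq_zero fun κ _ => ?_
    rw [show ctr 4 Lc = toSite (ctrOff 4 Lc) from rfl, symMixKerAt_eq_zero_of_not_near_bond (ctrOff_mem_box hLc) μ y (g := (κ, u)) hu,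
      symMixKerAt_eq_zero_of_not_near_bond (ctrOff_mem_box hLc) μ y (g := (κ, u)) hu, add_zero, mul_zero, mul_zero]

/-- [folklore] **`tsum_sum_grad_mul_compMixKer_two_even` — (K2b) AT DEPTH 2 IS STOREYWISE** (Engine C TIER V PHASE A's levelwise form, `γ = −1`, AS A THEOREM): for an1's (0.4)-SYM bricks
at the centred root at both levels, every coarse bond `(μ, y)`, every pair of finest bonds `f, f′` and every gauge function `λ`,
`Σ'_x Σ_α (λ(x+e_α) − λ x) · ½(compMix₂(μ,y;(α,x),f,f′) + compMix₂(μ,y;(α,x),f′,f))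
 = Σ_{κ₁,e₁,κ₂,e₂} (λ(Lc•(Lc•y+e₂) + ρ_c) − λ(Lc•(Lc•y+e₁) + ρ_c)) · h(μ,y;b₁,b₂) · ℓ(b₁;f) · ℓ(b₂;f′) + (λ x_{f′} − λ x_f) · Σ_{κ,e} ℓ(μ,y;b) · h(b;f,f′)`
(`b = (κ, Lc•y+e)`): the top storey's commutator with the ROOT-SAMPLED gauge function between the transports, plus the lower storey's commutator with the finest one. -/
theorem tsum_sum_grad_mul_compMixKer_two_even (lam : Site (3 + 1) → ℝ) (μ : Fin (3 + 1)) (y : Site (3 + 1)) (f f' : Bond (3 + 1)) :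
    ∑' x : Site (3 + 1), ∑ α : Fin (3 + 1), (lam (x + unitVec α) - lam x)
        * ((1 / 2 : ℝ) * (compMixKer (fun _ => symLinKerAt (ctr 4 Lc) Lc) (fun _ => symVhKerAt (ctr 4 Lc) Lc) (fun _ => symHessKerAt (ctr 4 Lc) Lc)
              (fun _ => symMixKerAt (ctr 4 Lc) Lc) Lc 2 μ y (α, x) f f'
            + compMixKer (fun _ => symLinKerAt (ctr 4 Lc) Lc) (fun _ => symVhKerAt (ctr 4 Lc) Lc) (fun _ => symHessKerAt (ctr 4 Lc) Lc)
              (fun _ => symMixKerAt (ctr 4 Lc) Lc) Lc 2 μ y (α, x) f' f))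
      = (∑ κ₁ : Fin (3 + 1), ∑ e₁ ∈ offs Lc, ∑ κ₂ : Fin (3 + 1), ∑ e₂ ∈ offs Lc,
          (lam ((Lc : ℤ) • ((Lc : ℤ) • y + e₂) + ctr 4 Lc) - lam ((Lc : ℤ) • ((Lc : ℤ) • y + e₁) + ctr 4 Lc))
            * symHessKerAt (ctr 4 Lc) Lc μ y (κ₁, (Lc : ℤ) • y + e₁) (κ₂, (Lc : ℤ) • y + e₂)
            * symLinKerAt (ctr 4 Lc) Lc κ₁ ((Lc : ℤ) • y + e₁) f * symLinKerAt (ctr 4 Lc) Lc κ₂ ((Lc : ℤ) • y + e₂) f')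
        + (lam f'.2 - lam f.2) * ∑ κ : Fin (3 + 1), ∑ e ∈ offs Lc,
            symLinKerAt (ctr 4 Lc) Lc μ y (κ, (Lc : ℤ) • y + e) * symHessKerAt (ctr 4 Lc) Lc κ ((Lc : ℤ) • y + e) f f' := by
  have hLc : 1 ≤ Lc := one_le_of_neZero Lc
  -- finite support in the fine site `x`: every piece vanishes unless `x` lies in the window of some level-1 bond of the window of `y`
  set W : Finset (Site (3 + 1)) := (offs Lc).biUnion fun e => (offs Lc).image fun e' => (Lc : ℤ) • ((Lc : ℤ) • y + e) + e' with hW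
  have hfar : ∀ x, x ∉ W → ∀ e ∈ offs Lc, ¬ Near Lc ((Lc : ℤ) • y + e) x := fun x hx e he hn => hx (by
    obtain ⟨e', he', rfl⟩ := near_iff_exists_offs.1 hn
    exact Finset.mem_biUnion.2 ⟨e, he, Finset.mem_image.2 ⟨e', he', rfl⟩⟩)
  -- the two storey integrands, per level-1 bond `b = (κ, Lc•y + e)`
  set C : Fin (3 + 1) → Site (3 + 1) → ℝ := fun κ e => (1 / 2 : ℝ) * ∑ κ₁ : Fin (3 + 1), ∑ e₁ ∈ offs Lc, ∑ κ₂ : Fin (3 + 1), ∑ e₂ ∈ offs Lc, 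
      (symMixKerAt (ctr 4 Lc) Lc μ y (κ, (Lc : ℤ) • y + e) (κ₁, (Lc : ℤ) • y + e₁) (κ₂, (Lc : ℤ) • y + e₂)
        + symMixKerAt (ctr 4 Lc) Lc μ y (κ, (Lc : ℤ) • y + e) (κ₂, (Lc : ℤ) • y + e₂) (κ₁, (Lc : ℤ) • y + e₁))
        * symLinKerAt (ctr 4 Lc) Lc κ₁ ((Lc : ℤ) • y + e₁) f * symLinKerAt (ctr 4 Lc) Lc κ₂ ((Lc : ℤ) • y + e₂) f' with hC
  -- (pointwise) the S1 sector: `Σ_α dλ·½·S1ᵉ = Σ_b (Σ_α dλ·ℓ(b;(α,x)))·C b`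
  have pull1 : ∀ x : Site (3 + 1), (∑ α : Fin (3 + 1), (lam (x + unitVec α) - lam x)
        * ((1 / 2 : ℝ) * ∑ κ : Fin (3 + 1), ∑ e ∈ offs Lc, ∑ κ₁ : Fin (3 + 1), ∑ e₁ ∈ offs Lc, ∑ κ₂ : Fin (3 + 1), ∑ e₂ ∈ offs Lc, 
          (symMixKerAt (ctr 4 Lc) Lc μ y (κ, (Lc : ℤ) • y + e) (κ₁, (Lc : ℤ) • y + e₁) (κ₂, (Lc : ℤ) • y + e₂)
            + symMixKerAt (ctr 4 Lc) Lc μ y (κ, (Lc : ℤ) • y + e) (κ₂, (Lc : ℤ) • y + e₂) (κ₁, (Lc : ℤ) • y + e₁))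
            * symLinKerAt (ctr 4 Lc) Lc κ ((Lc : ℤ) • y + e) (α, x) * symLinKerAt (ctr 4 Lc) Lc κ₁ ((Lc : ℤ) • y + e₁) f
            * symLinKerAt (ctr 4 Lc) Lc κ₂ ((Lc : ℤ) • y + e₂) f'))
      = ∑ κ : Fin (3 + 1), ∑ e ∈ offs Lc, (∑ α : Fin (3 + 1), (lam (x + unitVec α) - lam x) * symLinKerAt (ctr 4 Lc) Lc κ ((Lc : ℤ) • y + e) (α, x)) * C κ e := fun x => by
    simp only [hC]
    simp only [Finset.sum_mul]
    simp only [Finset.mul_sum]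
    refine Finset.sum_comm.trans (Finset.sum_congr rfl fun κ _ => Finset.sum_comm.trans (Finset.sum_congr rfl fun e _ =>
      Finset.sum_congr rfl fun α _ => Finset.sum_congr rfl fun κ₁ _ => Finset.sum_congr rfl fun e₁ _ => Finset.sum_congr rfl fun κ₂ _ =>
      Finset.sum_congr rfl fun e₂ _ => ?_))
    ring
  -- (pointwise) the S5 sector: `Σ_α dλ·½·S5ᵉ = Σ_b ℓ(μ,y;b)·(Σ_α dλ·½(t + t̃))`
  have pull5 : ∀ x : Site (3 + 1), (∑ α : Fin (3 + 1), (lam (x + unitVec α) - lam x)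
        * ((1 / 2 : ℝ) * ∑ κ : Fin (3 + 1), ∑ e ∈ offs Lc, symLinKerAt (ctr 4 Lc) Lc μ y (κ, (Lc : ℤ) • y + e)
          * (symMixKerAt (ctr 4 Lc) Lc κ ((Lc : ℤ) • y + e) (α, x) f f' + symMixKerAt (ctr 4 Lc) Lc κ ((Lc : ℤ) • y + e) (α, x) f' f)))
      = ∑ κ : Fin (3 + 1), ∑ e ∈ offs Lc, symLinKerAt (ctr 4 Lc) Lc μ y (κ, (Lc : ℤ) • y + e)
          * ∑ α : Fin (3 + 1), (lam (x + unitVec α) - lam x) * ((1 / 2 : ℝ) * (symMixKerAt (ctr 4 Lc) Lc κ ((Lc : ℤ) • y + e) (α, x) f f' + symMixKerAt (ctr 4 Lc) Lc κ ((Lc : ℤ) • y + e) (α, x) f' f)) := fun x => by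
    simp only [Finset.mul_sum]
    refine Finset.sum_comm.trans (Finset.sum_congr rfl fun κ _ => Finset.sum_comm.trans (Finset.sum_congr rfl fun e _ =>
      Finset.sum_congr rfl fun α _ => ?_))
    ring
  -- summability of the two pieces (finite support in `x`)
  have hs1 : ∀ (κ : Fin (3 + 1)) (e : Site (3 + 1)), e ∈ offs Lc → Summable fun x : Site (3 + 1) =>
      (∑ α : Fin (3 + 1), (lam (x + unitVec α) - lam x) * symLinKerAt (ctr 4 Lc) Lc κ ((Lc : ℤ) • y + e) (α, x)) * C κ e := fun κ e he =>
    summable_of_ne_finset_zero (s := W) fun x hx => by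
      rw [Finset.sum_eq_zero fun α _ => ?_, zero_mul]
      rw [show ctr 4 Lc = toSite (ctrOff 4 Lc) from rfl, symLinKerAt_eq_zero (ctrOff_mem_box hLc) (f := (α, x)) (hfar x hx e he), mul_zero]
  have hs5 : ∀ (κ : Fin (3 + 1)) (e : Site (3 + 1)), e ∈ offs Lc → Summable fun x : Site (3 + 1) =>
      symLinKerAt (ctr 4 Lc) Lc μ y (κ, (Lc : ℤ) • y + e) * ∑ α : Fin (3 + 1), (lam (x + unitVec α) - lam x) * ((1 / 2 : ℝ) * (symMixKerAt (ctr 4 Lc) Lc κ ((Lc : ℤ) • y + e) (α, x) f f' + symMixKerAt (ctr 4 Lc) Lc κ ((Lc : ℤ) • y + e) (α, x) f' f)) := fun κ e he =>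
    summable_of_ne_finset_zero (s := W) fun x hx => by
      rw [Finset.sum_eq_zero fun α _ => ?_, mul_zero]
      rw [show ctr 4 Lc = toSite (ctrOff 4 Lc) from rfl,
        symMixKerAt_eq_zero_of_not_near_bond (ctrOff_mem_box hLc) κ _ (g := (α, x)) (hfar x hx e he),
        symMixKerAt_eq_zero_of_not_near_bond (ctrOff_mem_box hLc) κ _ (g := (α, x)) (hfar x hx e he), add_zero, mul_zero, mul_zero]
  -- split the integrand into the two sectors (PART §2's even reduction), then the lattice sum into the two pieces
  have hsplit : ∀ x : Site (3 + 1), (∑ α : Fin (3 + 1), (lam (x + unitVec α) - lam x)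
        * ((1 / 2 : ℝ) * (compMixKer (fun _ => symLinKerAt (ctr 4 Lc) Lc) (fun _ => symVhKerAt (ctr 4 Lc) Lc) (fun _ => symHessKerAt (ctr 4 Lc) Lc)
              (fun _ => symMixKerAt (ctr 4 Lc) Lc) Lc 2 μ y (α, x) f f'
            + compMixKer (fun _ => symLinKerAt (ctr 4 Lc) Lc) (fun _ => symVhKerAt (ctr 4 Lc) Lc) (fun _ => symHessKerAt (ctr 4 Lc) Lc)
              (fun _ => symMixKerAt (ctr 4 Lc) Lc) Lc 2 μ y (α, x) f' f)))
      = (∑ κ : Fin (3 + 1), ∑ e ∈ offs Lc, (∑ α : Fin (3 + 1), (lam (x + unitVec α) - lam x) * symLinKerAt (ctr 4 Lc) Lc κ ((Lc : ℤ) • y + e) (α, x)) * C κ e)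
        + ∑ κ : Fin (3 + 1), ∑ e ∈ offs Lc, symLinKerAt (ctr 4 Lc) Lc μ y (κ, (Lc : ℤ) • y + e)
          * ∑ α : Fin (3 + 1), (lam (x + unitVec α) - lam x) * ((1 / 2 : ℝ) * (symMixKerAt (ctr 4 Lc) Lc κ ((Lc : ℤ) • y + e) (α, x) f f' + symMixKerAt (ctr 4 Lc) Lc κ ((Lc : ℤ) • y + e) (α, x) f' f)) := fun x => by
    rw [← pull1 x, ← pull5 x, ← Finset.sum_add_distrib]
    refine Finset.sum_congr rfl fun α _ => ?_
    rw [compMixKer_two_even_eq]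
    ring
  rw [tsum_congr hsplit, Summable.tsum_add (summable_sum fun κ _ => summable_sum fun e he => hs1 κ e he) (summable_sum fun κ _ => summable_sum fun e he => hs5 κ e he),
    Summable.tsum_finsetSum (fun κ _ => summable_sum fun e he => hs1 κ e he), Summable.tsum_finsetSum (fun κ _ => summable_sum fun e he => hs5 κ e he)]
  simp only [Summable.tsum_finsetSum (fun e he => hs1 _ e he), Summable.tsum_finsetSum (fun e he => hs5 _ e he), tsum_mul_right, tsum_mul_left]
  -- the two depth-1 letters: (W-lin)₁ on the S1 legs, the site law on the S5 bricks
  simp only [tsum_sum_grad_mul_symLinKerAt, tsum_sum_grad_mul_symMixKerAt_even]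
  congr 1
  · -- top storey: expand `C`, move the transporting bond `b` innermost, apply the site law AT LEVEL 1
    simp only [hC, Finset.mul_sum]
    rw [sum6_push2]
    refine Finset.sum_congr rfl fun κ₁ _ => Finset.sum_congr rfl fun e₁ _ => Finset.sum_congr rfl fun κ₂ _ => Finset.sum_congr rfl fun e₂ _ => ?_
    have hA2 := sum_offs_levelGrad_mul_symMixKerAt_even (Lc := Lc) lam μ y (κ₁, (Lc : ℤ) • y + e₁) (κ₂, (Lc : ℤ) • y + e₂)
    have hpull : (∑ κ : Fin (3 + 1), ∑ e ∈ offs Lc, (lam ((Lc : ℤ) • ((Lc : ℤ) • y + e + unitVec κ) + ctr 4 Lc) - lam ((Lc : ℤ) • ((Lc : ℤ) • y + e) + ctr 4 Lc))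
          * ((1 / 2 : ℝ) * ((symMixKerAt (ctr 4 Lc) Lc μ y (κ, (Lc : ℤ) • y + e) (κ₁, (Lc : ℤ) • y + e₁) (κ₂, (Lc : ℤ) • y + e₂)
              + symMixKerAt (ctr 4 Lc) Lc μ y (κ, (Lc : ℤ) • y + e) (κ₂, (Lc : ℤ) • y + e₂) (κ₁, (Lc : ℤ) • y + e₁))
              * symLinKerAt (ctr 4 Lc) Lc κ₁ ((Lc : ℤ) • y + e₁) f * symLinKerAt (ctr 4 Lc) Lc κ₂ ((Lc : ℤ) • y + e₂) f')))
        = (∑ κ : Fin (3 + 1), ∑ e ∈ offs Lc, (lam ((Lc : ℤ) • ((Lc : ℤ) • y + e + unitVec κ) + ctr 4 Lc) - lam ((Lc : ℤ) • ((Lc : ℤ) • y + e) + ctr 4 Lc))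
            * ((1 / 2 : ℝ) * (symMixKerAt (ctr 4 Lc) Lc μ y (κ, (Lc : ℤ) • y + e) (κ₁, (Lc : ℤ) • y + e₁) (κ₂, (Lc : ℤ) • y + e₂)
              + symMixKerAt (ctr 4 Lc) Lc μ y (κ, (Lc : ℤ) • y + e) (κ₂, (Lc : ℤ) • y + e₂) (κ₁, (Lc : ℤ) • y + e₁))))
          * (symLinKerAt (ctr 4 Lc) Lc κ₁ ((Lc : ℤ) • y + e₁) f * symLinKerAt (ctr 4 Lc) Lc κ₂ ((Lc : ℤ) • y + e₂) f') := by
      rw [Finset.sum_mul]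
      refine Finset.sum_congr rfl fun κ _ => ?_
      rw [Finset.sum_mul]
      refine Finset.sum_congr rfl fun e _ => ?_
      ring
    rw [hpull, hA2]
    ring
  · -- lower storey: pull the commutator scalar out
    rw [Finset.mul_sum]
    refine Finset.sum_congr rfl fun κ _ => ?_
    rw [Finset.mul_sum]
    refine Finset.sum_congr rfl fun e _ => ?_
    ring

end Summit.QuantumFields.BalabanUV.Beta.CombMixedT2EvenStoreyTwo

end
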